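import Literature.AnabelianGeometry.EtaleTheta.Discharge.Sec1ZNThetaImageInfDeltaTheta
import Literature.AnabelianGeometry.EtaleTheta.SettingModelTateDeckLevels
import HarnessLib

/-!
# [EtTh] §1 p. 20 «`Δ^tp_{Ÿ_N}/Δ^tp_{Z̈_N} ≅ Δ_Θ ⊗ ℤ/Nℤ`» at the two semi-synthetic models of record:
# `θ(Π^tp_{Z̈_N}) ∩ Δ_Θ = N·Δ_Θ` at `modelχ` and `modelχq`, every `N` (proof-only, by name)

Mochizuki, *The étale theta function and its Frobenioid-theoretic manifestations*, Publ. RIMS **45** (2009) [EtTh], §1 p. 20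
[cite: MochizukiEtTh2009, §1 p.20].  abc-iut cell, layer L2 = [EtTh], seat abc-iut-w6-d061 (gen 9), complement «ZN-Z̈-AT-MODELS»
of this seat's `Discharge/Sec1ZNThetaImageInfDeltaTheta.lean` (p505413; abc-iut-L2-lead R1239 «+ modelχ/modelχq instances BY NAME»),
item described by the root owner abc-iut-L2-t1 (STATUS 05:53:19Z: «Δ_Θ has y-coordinate 0 at every level»).  PROOF-ONLY: no
definition, no new named fact.  The generic `Z̈_N` lemma `ThetaSetting.map_toTheta_gtpZddN_inf_deltaTheta` displays the input
`Δ_Θ ≤ θ(Δ^tp_{Y_{2N}})`, a theorem at Tate origins — but `modelχ` is NOT a Tate origin (`modelχ_not_isTateOrigin`), so at the models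
the input is proved by DIRECT coordinates: every element of `Δ_Θ` is `θ(inl c^t)` (abc-iut-L2-d1 / abc-iut-L6-d6 `exists_cThetaχ_eq_of_mem_ker`,
`exists_cThetaχq_eq_of_mem_ker`), and `inl c^t ∈ Π^tp_{Y_M} ∩ Δ^tp_X` for every `M` because `ĥ_M(c^t) = (0, 0, t mod M)` lies on the
`z`-axis (abc-iut-L2-t6 `hHat_gfpFst_cGfpχ`) and `c^t` has degree `0`.
* `SettingModel.inl_cGfpχ_mem_dtpYN_modelχ` / `…_modelχq` — `inl(c^t) ∈ Δ^tp_{Y_M}` at both models, every `M`;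
* `SettingModel.deltaTheta_le_map_toTheta_dtpYN_modelχ` / `…_modelχq` — `Δ_Θ ≤ θ(Δ^tp_{Y_M})`;
* **`SettingModel.map_toTheta_gtpZddN_inf_deltaTheta_modelχ` / `…_modelχq`** — `θ(Π^tp_{Z̈_N}) ∩ Δ_Θ = N·Δ_Θ`, every `N`.
HONEST FRAMING: semi-synthetic models witness OUR clauses only; nothing of [EtTh] (refereed) is asserted for the genuine tempered
fundamental group; nothing here bears on [IUTchIII] Cor. 3.12; no side taken; typed ≠ proved.
-/

noncomputable section

namespace Literature.AnabelianGeometry.EtaleTheta.SettingModel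

open Literature.AnabelianGeometry.SemiGraphs

variable (p : ℕ) [Fact p.Prime]

/-! ### The χ-twisted model `modelχ` -/

/-- `inl(c^t) ∈ Δ^tp_{Y_M}` at `modelχ` for every `M`: degree `0`, levels `(0, 0, t mod M)` on the `z`-axis, Galois part `1`.
[cite: MochizukiEtTh2009, §1 p.13] -/
theorem inl_cGfpχ_mem_dtpYN_modelχ (M : ℕ+) (t : ZH) :
    (SemidirectProduct.inl (cGfpχ t) : PiTpχ p) ∈ (ThetaSetting.modelχ p).DtpYN M := by
  refine Subgroup.mem_inf.mpr ⟨?_, inl_mem_deltaTempχ p (cGfpχ t)⟩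
  change (SemidirectProduct.inl (cGfpχ t) : PiTpχ p) ∈ YNχ p M
  refine (GfpTwistData.mem_YN _).mpr ⟨?_, by rw [SemidirectProduct.right_inl]; exact Subgroup.one_mem _⟩
  rw [SemidirectProduct.left_inl]
  refine Subgroup.mem_inf.mpr ⟨rfl, Subgroup.mem_comap.mpr ?_⟩
  change hHat M (gfpFst (cGfpχ t)) ∈ Heis.zAxis
  rw [hHat_gfpFst_cGfpχ]
  exact ⟨rfl, rfl⟩

/-- **`Δ_Θ ≤ θ(Δ^tp_{Y_M})` at `modelχ`, every `M`** («Δ_Θ has y-coordinate 0 at every level»).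
[cite: MochizukiEtTh2009, §1 p.13] -/
theorem deltaTheta_le_map_toTheta_dtpYN_modelχ (M : ℕ+) :
    (ThetaSetting.modelχ p).DeltaTheta ≤ ((ThetaSetting.modelχ p).DtpYN M).map (ThetaSetting.modelχ p).toTheta := by
  intro d hd
  obtain ⟨t, rfl⟩ := exists_cThetaχ_eq_of_mem_ker p hd
  exact ⟨SemidirectProduct.inl (cGfpχ t), inl_cGfpχ_mem_dtpYN_modelχ p M t, (cThetaχ_apply p t).symm⟩

/-- **`θ(Π^tp_{Z̈_N}) ∩ Δ_Θ = N·Δ_Θ` at `modelχ`, every `N`** (p. 20), by this seat's generic `Z̈_N` lemma with the ∃-form of the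
`Z_N` clause (`exists_thetaSplitting_gtpZN_iff_modelχ`), the guard (`modelχ_isEtThOrigin`) and the coordinate input at level `2N`.
[cite: MochizukiEtTh2009, §1 p.20] -/
theorem map_toTheta_gtpZddN_inf_deltaTheta_modelχ (N : ℕ+) :
    ((ThetaSetting.modelχ p).GtpZddN N).map (ThetaSetting.modelχ p).toTheta ⊓ (ThetaSetting.modelχ p).DeltaTheta =
      (ThetaSetting.modelχ p).lDeltaTheta N := by
  obtain ⟨s, hs, hcl⟩ := exists_thetaSplitting_gtpZN_iff_modelχ p N
  exact (ThetaSetting.modelχ p).map_toTheta_gtpZddN_inf_deltaTheta N (ThetaSetting.modelχ_isEtThOrigin p) hs hcl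
    (deltaTheta_le_map_toTheta_dtpYN_modelχ p (2 * N))

/-! ### The stage-2 model `modelχq p i j` (`j` even) -/

section Tate

variable (i j : ℤ) (hj : Even j)

/-- `inl(c^t) ∈ Δ^tp_{Y_M}` at `modelχq`, every `M` (same coordinates; the shear changes the Galois action, not `Δ^tp_X`).
[cite: MochizukiEtTh2009, §1 p.13] -/
theorem inl_cGfpχ_mem_dtpYN_modelχq (M : ℕ+) (t : ZH) :
    (SemidirectProduct.inl (cGfpχ t) : PiTpχq p i j) ∈ (ThetaSetting.modelχq p i j hj).DtpYN M := by
  refine Subgroup.mem_inf.mpr ⟨?_, inl_mem_deltaTempχq p i j (cGfpχ t)⟩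
  change (SemidirectProduct.inl (cGfpχ t) : PiTpχq p i j) ∈ YNχq p i j M
  refine (GfpTwistData₀.mem_YN _).mpr ⟨?_, by rw [SemidirectProduct.right_inl]; exact Subgroup.one_mem _⟩
  rw [SemidirectProduct.left_inl]
  refine Subgroup.mem_inf.mpr ⟨rfl, Subgroup.mem_comap.mpr ?_⟩
  change hHat M (gfpFst (cGfpχ t)) ∈ Heis.zAxis
  rw [hHat_gfpFst_cGfpχ]
  exact ⟨rfl, rfl⟩

/-- **`Δ_Θ ≤ θ(Δ^tp_{Y_M})` at `modelχq`, every `M`.** [cite: MochizukiEtTh2009, §1 p.13] -/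
theorem deltaTheta_le_map_toTheta_dtpYN_modelχq (M : ℕ+) :
    (ThetaSetting.modelχq p i j hj).DeltaTheta ≤
      ((ThetaSetting.modelχq p i j hj).DtpYN M).map (ThetaSetting.modelχq p i j hj).toTheta := by
  intro d hd
  obtain ⟨t, rfl⟩ := exists_cThetaχq_eq_of_mem_ker p i j hd
  exact ⟨SemidirectProduct.inl (cGfpχ t), inl_cGfpχ_mem_dtpYN_modelχq p i j hj M t, (cThetaχq_apply p i j t).symm⟩

/-- **`θ(Π^tp_{Z̈_N}) ∩ Δ_Θ = N·Δ_Θ` at `modelχq`, every `N`** (p. 20). [cite: MochizukiEtTh2009, §1 p.20] -/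
theorem map_toTheta_gtpZddN_inf_deltaTheta_modelχq (N : ℕ+) :
    ((ThetaSetting.modelχq p i j hj).GtpZddN N).map (ThetaSetting.modelχq p i j hj).toTheta ⊓
        (ThetaSetting.modelχq p i j hj).DeltaTheta = (ThetaSetting.modelχq p i j hj).lDeltaTheta N := by
  obtain ⟨s, hs, hcl⟩ := exists_thetaSplitting_gtpZN_iff_modelχq p i j hj N
  exact (ThetaSetting.modelχq p i j hj).map_toTheta_gtpZddN_inf_deltaTheta N (ThetaSetting.modelχq_isEtThOrigin p i j hj) hs hcl
    (deltaTheta_le_map_toTheta_dtpYN_modelχq p i j hj (2 * N))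

end Tate

end Literature.AnabelianGeometry.EtaleTheta.SettingModel

end
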